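import Mathlib
import Summits.Langlands.Langlands.Theses.NonParallelVoid
import Literature.NumberTheory.GaloisRepresentations.PstCrystallineExtensionData
import Literature.NumberTheory.GaloisRepresentations.EnormousSubgroup
import Literature.NumberTheory.GaloisRepresentations.ProjectiveType
import Literature.NumberTheory.GaloisRepresentations.DecomposedGeneric
import Literature.NumberTheory.GaloisRepresentations.AbsGaloisGroup
import Literature.NumberTheory.GaloisRepresentations.AbsGaloisOuterConj
import Literature.NumberTheory.GaloisRepresentations.ToLocalRestrictField
import Literature.NumberTheory.Automorphic.Qian2022PotentialAutomorphy
import Literature.NumberTheory.Automorphic.BLGGT2014PotentialAutomorphy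
import Literature.NumberTheory.Automorphic.CaraianiLeHungComplexConjugation
import Literature.NumberTheory.Automorphic.AHTW2026HodgeTateWeights
import Literature.NumberTheory.PAdicHodge.LabelledHodgeTateWeightsBaseChangeLabelwise
import Literature.FieldTheory.AlgClosed.PadicAlgClEquivComplex
import HarnessLib

/-!
# Stub `stub_traceComplexConjugation` of line `merged` (v2) for crux `TensorSquareParallel` (stmt-Langlands-17009)

The "complex conjugation has trace zero" step of Calegari's tensor-induction line: for a prime
`p ≥ 11` and a continuous `ψ : Γ_ℚ → GL₄(ℚ̄_p)` which is (T1) unramified almost everywhere,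
(T2) orthogonal with totally even multiplier (`ψᵀ J ψ = μ • J`, `J` symmetric invertible,
`μ(c) = 1` at complex conjugations), (T3') crystalline with `4` distinct labelled Hodge–Tate weights and
potentially diagonalizable at `p` (with the non-vacuity witness
`Nonempty (PstCrystallineExtensionData (fontainePstAdicCompletion v p hv))`), and residually absolutely
irreducible on `Γ_{ℚ(ζ_p)}`, the trace of `ψ(c)` vanishes for every complex conjugation `c ∈ Γ_ℚ` —
GRANTED the two named literature facts, which the registered signature carries as its first two
antecedents:

* `BLGGT2014_thmC_potentialAutomorphy` ([BarnetlambEtAl2014] Thm. C = Cor. 4.5.2, through its proved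
  projection `BLGGT2014_thmC_potentialAutomorphy.rat_GO_even` onto the `GO`/even shape over `ℚ`): there is
  a finite Galois totally real `F'/ℚ` with `ψ|_{Γ_{F'}}` semisimple and HLTT-compatible with a regular
  algebraic cuspidal `π` of `GL₄(𝔸_{F'})` (here `2 · (4 + 1) = 10 ≤ 11 ≤ p`);
* `CaraianiLeHung2016_thm_1_1` ([CaraianiLeHung2016] Thm. 1.1): for such `(π, ψ|_{Γ_{F'}})` and `n = 4`
  even, `tr ψ(c') = 0` for every complex conjugation `c'` of `Γ_{F'}`.

## Proof (registered skeleton `work/TensorSquareParallel.lean` v2, stub `stub_traceComplexConjugation`)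

Fix `ι : ℚ̄_p ≃+* ℂ` (`PadicAlgCl.nonempty_ringEquiv_complex`).  Thm. C (`rat_GO_even`, fed (T1), (T2),
the (T3')-conjuncts re-packed into its `hloc`/`hne` shape, and the residual irreducibility) gives
`F'`, `π`.  The totally real `F'` has a real place `w`, hence a complex conjugation `c' ∈ Γ_{F'}`
(`exists_isComplexConjugation`), and Caraiani–Le Hung gives `tr (ψ|_{Γ_{F'}})(c') = 0`.  Transport to the
GIVEN `c ∈ Γ_ℚ`: `res_ℚ^{F'} c'` is a complex conjugation of `Γ_ℚ` for THE embedding `ℚ → ℝ`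
(`isComplexConjugation_absGaloisRestrict_rat'`; `ℚ →+* ℝ` is a subsingleton, so `φ = algebraMap ℚ ℝ`),
hence conjugate to `c` (`IsComplexConjugation.isConj`), and the trace is conjugation invariant
(`Matrix.trace_units_conj`, `FramedGaloisRep.restrictField_apply`).

## References

* [BarnetlambEtAl2014] T. Barnet-Lamb, T. Gee, D. Geraghty, R. Taylor, *Potential automorphy and change
  of weight*, Ann. of Math. 179 (2014) 501–609, Thm. C / Cor. 4.5.2.
* [CaraianiLeHung2016] A. Caraiani, B. V. Le Hung, *On the image of complex conjugation in certain Galois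
  representations*, Compos. Math. 152 (2016) 1476–1488, Thm. 1.1.
* [Calegari2010] F. Calegari, *Even Galois representations and the Fontaine–Mazur conjecture*,
  Invent. Math. 185 (2011) 1–16, §6 (the use of Thm. C + the sign of complex conjugation).
-/

noncomputable section

set_option linter.dupNamespace false  -- `Summit.Langlands.Langlands.…` is the mandated summit-side namespace (D-0022)

open scoped NumberField Kronecker
open IsDedekindDomain Field
open Literature.NumberTheory.GaloisRepresentations Literature.NumberTheory.PAdicHodge
  Literature.NumberTheory.Automorphic

namespace Summit.Langlands.Langlands.Theorems.TensorSquareParallel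

/-- **Restriction to `Γ_ℚ` of a complex conjugation of `Γ_M` is a complex conjugation** (for THE
embedding `ℚ → ℝ`).  Stated for an ARBITRARY `[Algebra ℚ M]` (not `algebraRat`): the extension `F'`
produced by Thm. C comes with its own `Algebra ℚ F'`, and `restrictField` is taken along it.  If `c`
acts as complex conjugation under an embedding `i : M̄ → ℂ` over a real embedding of `M`, then
`res_ℚ^M c` acts as complex conjugation under `i ∘ (ℚ̄ → M̄)` (`absGaloisRestrict_apply_smul`). -/
-- adapted from Summits/Langlands/Langlands/Theorems/PicardMuOrdinaryMuOrdinaryFamilyRTThornePolarizationTransport.lean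
-- (`isComplexConjugation_absGaloisRestrict_rat`, the `[CharZero M]`/`algebraRat` version; not imported here)
theorem isComplexConjugation_absGaloisRestrict_rat' {M : Type*} [Field M] [Algebra ℚ M] {φ : M →+* ℝ}
    {c : absoluteGaloisGroup M} (hc : IsComplexConjugation φ c) :
    IsComplexConjugation (algebraMap ℚ ℝ) (absGaloisRestrict ℚ M c) := by
  obtain ⟨i, -, hic⟩ := isComplexConjugation_iff.mp hc
  refine isComplexConjugation_iff.mpr
    ⟨i.comp (absClosureEmbedding ℚ M : AlgebraicClosure ℚ →+* AlgebraicClosure M),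
      Subsingleton.elim _ _, fun x ↦ ?_⟩
  simp only [RingHom.comp_apply, RingHom.coe_coe]
  rw [absGaloisRestrict_apply_smul]
  exact hic _

/-- **Stub `stub_traceComplexConjugation` (v2): BLGGT Thm. C + Caraiani–Le Hung Thm. 1.1 for `n = 4`
over `ℚ`.**  Granted `BLGGT2014_thmC_potentialAutomorphy` and `CaraianiLeHung2016_thm_1_1`, for `p ≥ 11`
and `ψ : Γ_ℚ → GL₄(ℚ̄_p)` satisfying (T1) a.e. unramified, (T2) orthogonal with totally even multiplier,
(T3') crystalline with `4` distinct labelled Hodge–Tate weights, a `PstCrystallineExtensionData` witness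
and potential diagonalizability above `p`, and residual absolute irreducibility on `Γ_{ℚ(ζ_p)}`, every
complex conjugation `c ∈ Γ_ℚ` has `tr ψ(c) = 0`.  Proof: `ψ|_{Γ_{F'}}` is automorphic for a totally
real Galois `F'/ℚ` (Thm. C, `rat_GO_even`), so `tr ψ(c') = 0` for a complex conjugation `c'` of
`Γ_{F'}` (Caraiani–Le Hung, `n = 4` even), and `res c'` is conjugate to `c` in `Γ_ℚ`. -/
theorem stub_traceComplexConjugation :
    BLGGT2014_thmC_potentialAutomorphy → CaraianiLeHung2016_thm_1_1 → ∀ (p : ℕ) [Fact p.Prime], 11 ≤ p → ∀ ψ : FramedGaloisRep ℚ (PadicAlgCl p) 4, (∀ᶠ v : HeightOneSpectrum (𝓞 ℚ) in Filter.cofinite, ψ.IsUnramifiedAt v) → (∃ (J : Matrix (Fin 4) (Fin 4) (PadicAlgCl p)) (μ : absoluteGaloisGroup ℚ →* (PadicAlgCl p)ˣ), J.IsSymm ∧ IsUnit J.det ∧ (∀ g : absoluteGaloisGroup ℚ, (ψ g).val.transpose * J * (ψ g).val = (μ g : PadicAlgCl p) • J) ∧ ∀ (φ : ℚ →+* ℝ)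 (c : absoluteGaloisGroup ℚ), IsComplexConjugation φ c → μ c = 1) → (∀ (v : HeightOneSpectrum (𝓞 ℚ)) (hv : ((p : ℕ) : 𝓞 ℚ) ∈ v.asIdeal), (fontainePstAdicCompletion v p hv).IsCrystallineFramed (ψ.toLocal v) ∧ (letI := (fontainePstAdicCompletion v p hv).algebra; (∀ τ : v.adicCompletion ℚ →ₐ[ℚ_[p]] PadicAlgCl p, (let M := ψ.labelledHodgeTateWeightsAt v (fontainePstAdicCompletion v p hv).algebra (fontainePstAdicCompletion v p hv).𝔅 τ.toRingHom; M.Nodup ∧ Multiset.card M = 4)) ∧ Nonempty (PstCrystallineExtensionData (fontainePstAdicCompletion v p hv)) ∧ ∀ 𝔈 : PstCrystallineExtensionData (fontainePstAdicCompletion v p hv), IsPotentiallyDiagonalizable 𝔈.𝔅 (ψ.toLocal v))) → FramedGaloisRep.IsResiduallyAbsIrreducible (ψ.restrictField (CyclotomicField p ℚ)) → ∀ (φ : ℚ →+* ℝ) (c : absoluteGaloisGroup ℚ), IsComplexConjugation φ c → (ψ c).val.trace = 0 := by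
  intro hC hCLH p _ hp ψ hunr hT2 hT3 hirr φ c hc
  obtain ⟨ι⟩ := PadicAlgCl.nonempty_ringEquiv_complex p
  -- Thm. C over `ℚ`, `GO`/even shape: `2 · (4 + 1) ≤ 11 ≤ p`; (T3') re-packed into `hloc` and `hne`
  obtain ⟨F', _, _, _, -, hTR, hss, hcpt, π, hπ, hcomp⟩ :=
    hC.rat_GO_even (by norm_num) (by omega) ι ψ hunr hT2
      (fun v hv => ⟨(hT3 v hv).1, (hT3 v hv).2.1, (hT3 v hv).2.2.2⟩)
      (fun v hv => (hT3 v hv).2.2.1) hirr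
  haveI := hTR
  -- a complex conjugation `c'` of `Γ_{F'}` at a (real) infinite place of the totally real `F'`
  obtain ⟨w⟩ : Nonempty (NumberField.InfinitePlace F') := inferInstance
  obtain ⟨c', hc'⟩ := exists_isComplexConjugation
    (NumberField.InfinitePlace.embedding_of_isReal (NumberField.IsTotallyReal.isReal w))
  -- Caraiani–Le Hung for `ψ|_{Γ_{F'}}` (semisimple, HLTT-compatible with the regular algebraic `π`)
  have h0 : ((ψ.restrictField F' c' : GL (Fin 4) (PadicAlgCl p)) :
      Matrix (Fin 4) (Fin 4) (PadicAlgCl p)).trace = 0 :=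
    (hCLH F' hTR 4 hcpt π hπ p ι (ψ.restrictField F') hss hcomp _ c' hc').1 ⟨2, rfl⟩
  -- transport: `res c'` is a complex conjugation of `Γ_ℚ`, hence conjugate to `c`
  have hcc : IsComplexConjugation (algebraMap ℚ ℝ) (absGaloisRestrict ℚ F' c') :=
    isComplexConjugation_absGaloisRestrict_rat' hc'
  obtain rfl : φ = algebraMap ℚ ℝ := Subsingleton.elim _ _
  obtain ⟨u, hu⟩ := isConj_iff.mp (hc.isConj hcc)
  rw [FramedGaloisRep.restrictField_apply, ← hu, map_mul, map_mul, map_inv, Units.val_mul,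
    Units.val_mul, Matrix.trace_units_conj] at h0
  exact h0

end Summit.Langlands.Langlands.Theorems.TensorSquareParallel

end
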